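import Mathlib.Analysis.InnerProductSpace.PiL2
import Mathlib.Analysis.Calculus.ContDiff.Basic
import Mathlib.Analysis.Calculus.MeanValue
import Mathlib.MeasureTheory.Integral.Bochner.Set
import Mathlib.MeasureTheory.Measure.Haar.InnerProductSpace
import Mathlib.Topology.UniformSpace.HeineCantor
import Literature.MathematicalPhysics.QuantumFieldTheory.Balaban1983to89.B4Eq19LatticeOperators
import HarnessLib

/-!
# Crux `HistoryTailL` (stmt-QuantumFields-19936), K2 organ `hImproveCoreFlat`, road R1 (LINE 25 `CompactnessTransfer`, stub S2) — FILE B3-b1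
# «GRID CELLS AND THE FROZEN-DERIVATIVE MEAN VALUE STEP»: the cube ∕ cell ∕ volume ∕ disjointness letters in `ℝ³` and the one-bond sampling
# estimate used by B3-b2 `…PoincareLipschitzSamplingConsistency.lattice_energy_sample_le` (sampling consistency from above)

Cell `ym3-torus` (YM ladder rung R3 = continuum SU(2) Yang–Mills on T³ — a RUNG, NOT the Clay problem: not d = 4, not infinite volume, not a mass
gap); TWIN-WIDTH helper seat `ym-ust-19936-w7` g13 (LEAD ★w1-19936 g9 10:49:08Z «B3-b GO»).  Helper `--supports stmt-QuantumFields-19936`; THEOREMS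
ONLY (0 `def`, 0 `sorry`, default heartbeats); Mathlib + lit ✓`B4Eq19LatticeOperators` (`Zd 3`, `box`, `unitVec`).

WHAT IS PROVED (ns `…Theorems.PoincareLipschitzSamplingCells`).
* §1 `isOpen_absCube`, `absCube_subset_closedBall`, `isCompact_absCubeClosed`, `measurableSet_cell`, `volume_real_cell` (the open grid cell
  `Π (yᵢ∕R, (yᵢ+1)∕R)` has volume `R⁻³`), `closedCell_subset_absCube` ∕ `cell_subset_absCube` (cells over `Q_{⌊sR⌋}(0)` lie in `{|xᵢ| < s′}` once
  `R⁻¹ < s′ − s`), `dist_le_of_mem_closedCell` (`≤ 2∕R`), `disjoint_cell`, `volume_real_absCube` (`= 8t³`).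
* §2 `sq_add_le_weighted` (`(a + b)² ≤ (1+θ)a² + (1+θ⁻¹)b²`), ★`norm_sample_sub_le` — the frozen-derivative mean value step on one bond
  (Mathlib ✓`Convex.norm_image_sub_le_of_norm_hasFDerivWithin_le'`): `‖V(a + R⁻¹e) − V a‖ ≤ R⁻¹(‖D x₀ e‖ + ω)` when `‖D − D x₀‖ ≤ ω` on a convex
  set containing the bond.
HONEST SCOPE.  Letters; S1′∕S2 of LINE 25, `hImproveCoreFlat`, K1, `MeanDeviationL`, `BlockLipschitzL`, `HistoryTailL` are NOT proved here.  YM₃ on T³ is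
rung R3, not Clay; YM gap NOT proved; no summit statement is proved here.

References: R. Alicandro, M. Cicalese, SIAM J. Math. Anal. 2008 [AlicandroCicalese2008] (Γ-limits of spin lattice energies); L. Simon, Theorems on
Regularity and Singularity of Energy Minimizing Maps (1996) §2.9.
-/

set_option autoImplicit false

noncomputable section

open scoped BigOperators
open MeasureTheory Set Finset Metric

namespace Summit.QuantumFields.YangMills.Theorems.PoincareLipschitzSamplingCells

open Literature.MathematicalPhysics.QuantumFieldTheory.Balaban1983to89
open B4Eq19LatticeOperators (Zd box unitVec mem_box)

/-! ## §1 Cubes and grid cells in `ℝ³` -/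

/-- The open sup-norm cube `{|xᵢ| < t}` is open. [folklore] -/
theorem isOpen_absCube (t : ℝ) : IsOpen {x : EuclideanSpace ℝ (Fin 3) | ∀ i : Fin 3, |x i| < t} := by
  have : {x : EuclideanSpace ℝ (Fin 3) | ∀ i : Fin 3, |x i| < t} = ⋂ i : Fin 3, {x | |x i| < t} := by
    ext x; simp
  rw [this]
  exact isOpen_iInter_of_finite fun i =>
    isOpen_lt (continuous_abs.comp (EuclideanSpace.proj i).continuous) continuous_const

/-- The closed sup-norm cube `{|xᵢ| ≤ t}` lies in the Euclidean closed ball of radius `2t` (`t ≥ 0`). [folklore] -/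
theorem absCube_subset_closedBall {t : ℝ} (ht : 0 ≤ t) :
    {x : EuclideanSpace ℝ (Fin 3) | ∀ i : Fin 3, |x i| ≤ t} ⊆ closedBall 0 (2 * t) := by
  intro x hx
  rw [mem_closedBall, dist_zero_right, EuclideanSpace.norm_eq]
  have hsum : ∑ i : Fin 3, ‖x i‖ ^ 2 ≤ 3 * t ^ 2 := by
    calc ∑ i : Fin 3, ‖x i‖ ^ 2 ≤ ∑ _i : Fin 3, t ^ 2 := Finset.sum_le_sum fun i _ => by
            rw [Real.norm_eq_abs]; exact pow_le_pow_left₀ (abs_nonneg _) (hx i) 2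
      _ = 3 * t ^ 2 := by simp
  calc √(∑ i : Fin 3, ‖x i‖ ^ 2) ≤ √(3 * t ^ 2) := Real.sqrt_le_sqrt hsum
    _ ≤ √((2 * t) ^ 2) := Real.sqrt_le_sqrt (by nlinarith)
    _ = 2 * t := Real.sqrt_sq (by linarith)

/-- The closed sup-norm cube `{|xᵢ| ≤ t}` is compact. [folklore] -/
theorem isCompact_absCubeClosed {t : ℝ} (ht : 0 ≤ t) : IsCompact {x : EuclideanSpace ℝ (Fin 3) | ∀ i : Fin 3, |x i| ≤ t} := by
  refine (isCompact_closedBall (0 : EuclideanSpace ℝ (Fin 3)) (2 * t)).of_isClosed_subset ?_ (absCube_subset_closedBall ht)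
  have : {x : EuclideanSpace ℝ (Fin 3) | ∀ i : Fin 3, |x i| ≤ t} = ⋂ i : Fin 3, {x | |x i| ≤ t} := by
    ext x; simp
  rw [this]
  exact isClosed_iInter fun i => isClosed_le (continuous_abs.comp (EuclideanSpace.proj i).continuous) continuous_const

/-- The open grid cell `Π (yᵢ∕R, (yᵢ+1)∕R)` is measurable. [folklore] -/
theorem measurableSet_cell (R : ℕ) (y : Zd 3) :
    MeasurableSet {x : EuclideanSpace ℝ (Fin 3) | ∀ i, (y i : ℝ) / R < x i ∧ x i < ((y i : ℝ) + 1) / R} := by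
  have h : {x : EuclideanSpace ℝ (Fin 3) | ∀ i, (y i : ℝ) / R < x i ∧ x i < ((y i : ℝ) + 1) / R} =
      (WithLp.ofLp : EuclideanSpace ℝ (Fin 3) → (Fin 3 → ℝ)) ⁻¹'
        (Set.pi univ fun i => Ioo ((y i : ℝ) / R) (((y i : ℝ) + 1) / R)) := by
    ext x; simp [Set.mem_pi]
  rw [h]
  exact (MeasurableSet.univ_pi fun i => measurableSet_Ioo).preimage (PiLp.volume_preserving_ofLp (Fin 3)).measurable

/-- Volume of the open grid cell `Π (yᵢ∕R, (yᵢ+1)∕R)`: `R⁻³` (as a real number). [folklore] -/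
theorem volume_real_cell (R : ℕ) (hR : 0 < R) (y : Zd 3) :
    (volume {x : EuclideanSpace ℝ (Fin 3) | ∀ i, (y i : ℝ) / R < x i ∧ x i < ((y i : ℝ) + 1) / R}).toReal = ((R : ℝ)⁻¹) ^ 3 := by
  have hR0 : (0 : ℝ) < R := by exact_mod_cast hR
  have h : {x : EuclideanSpace ℝ (Fin 3) | ∀ i, (y i : ℝ) / R < x i ∧ x i < ((y i : ℝ) + 1) / R} =
      (WithLp.ofLp : EuclideanSpace ℝ (Fin 3) → (Fin 3 → ℝ)) ⁻¹'
        (Set.pi univ fun i => Ioo ((y i : ℝ) / R) (((y i : ℝ) + 1) / R)) := by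
    ext x; simp [Set.mem_pi]
  rw [h, (PiLp.volume_preserving_ofLp (Fin 3)).measure_preimage
    (MeasurableSet.univ_pi fun i => measurableSet_Ioo).nullMeasurableSet, Real.volume_pi_Ioo]
  have hdiff : ∀ i : Fin 3, ((y i : ℝ) + 1) / R - (y i : ℝ) / R = (R : ℝ)⁻¹ := fun i => by
    field_simp; ring
  simp only [hdiff, Finset.prod_const, Finset.card_univ, Fintype.card_fin]
  rw [ENNReal.toReal_pow, ENNReal.toReal_ofReal (inv_nonneg.mpr hR0.le)]

/-- For `y ∈ Q_{⌊sR⌋}(0)` and `R⁻¹ < s′ − s`, the CLOSED grid cell `Π [yᵢ∕R, (yᵢ+1)∕R]` lies in the open cube `{|xᵢ| < s′}`. [folklore] -/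
theorem closedCell_subset_absCube {R : ℕ} (hR : 0 < R) {s s' : ℝ} (hRs : (R : ℝ)⁻¹ < s' - s)
    {y : Zd 3} (hy : y ∈ box (0 : Zd 3) ⌊s * R⌋) :
    {x : EuclideanSpace ℝ (Fin 3) | ∀ i, (y i : ℝ) / R ≤ x i ∧ x i ≤ ((y i : ℝ) + 1) / R} ⊆
      {x : EuclideanSpace ℝ (Fin 3) | ∀ i : Fin 3, |x i| < s'} := by
  intro x hx i
  have hR0 : (0 : ℝ) < R := by exact_mod_cast hR
  have hRinv : 0 < (R : ℝ)⁻¹ := inv_pos.mpr hR0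
  have hyi : |(y i : ℝ)| ≤ s * R := by
    have h1 : |y i - (0 : Zd 3) i| ≤ ⌊s * R⌋ := (mem_box.mp hy) i
    simp only [Pi.zero_apply, sub_zero] at h1
    have h2 : |(y i : ℝ)| ≤ (⌊s * R⌋ : ℝ) := by
      have := (Int.cast_le (R := ℝ)).mpr h1
      simpa [Int.cast_abs] using this
    exact h2.trans (Int.floor_le _)
  obtain ⟨hlo, hhi⟩ := hx i
  rw [abs_lt]
  rw [abs_le] at hyi
  constructor
  · have h4 : -s ≤ (y i : ℝ) / R := by
      rw [le_div_iff₀ hR0]; linarith [hyi.1]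
    linarith
  · have h4 : ((y i : ℝ) + 1) / R ≤ s + (R : ℝ)⁻¹ := by
      rw [div_le_iff₀ hR0, add_mul, inv_mul_cancel₀ hR0.ne']; linarith [hyi.2]
    linarith

/-- The open grid cell lies in the closed one, hence in the open cube `{|xᵢ| < s′}`. [folklore] -/
theorem cell_subset_absCube {R : ℕ} (hR : 0 < R) {s s' : ℝ} (hRs : (R : ℝ)⁻¹ < s' - s)
    {y : Zd 3} (hy : y ∈ box (0 : Zd 3) ⌊s * R⌋) :
    {x : EuclideanSpace ℝ (Fin 3) | ∀ i, (y i : ℝ) / R < x i ∧ x i < ((y i : ℝ) + 1) / R} ⊆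
      {x : EuclideanSpace ℝ (Fin 3) | ∀ i : Fin 3, |x i| < s'} :=
  fun _ hx => closedCell_subset_absCube hR hRs hy (fun i => ⟨(hx i).1.le, (hx i).2.le⟩)

/-- Two points of a closed grid cell are at Euclidean distance `≤ 2∕R`. [folklore] -/
theorem dist_le_of_mem_closedCell {R : ℕ} (hR : 0 < R) {y : Zd 3} {x z : EuclideanSpace ℝ (Fin 3)}
    (hx : ∀ i, (y i : ℝ) / R ≤ x i ∧ x i ≤ ((y i : ℝ) + 1) / R)
    (hz : ∀ i, (y i : ℝ) / R ≤ z i ∧ z i ≤ ((y i : ℝ) + 1) / R) : dist x z ≤ 2 / R := by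
  have hR0 : (0 : ℝ) < R := by exact_mod_cast hR
  rw [EuclideanSpace.dist_eq]
  have hcoord : ∀ i : Fin 3, dist (x i) (z i) ^ 2 ≤ ((R : ℝ)⁻¹) ^ 2 := by
    intro i
    have hw : ((y i : ℝ) + 1) / R - (y i : ℝ) / R = (R : ℝ)⁻¹ := by field_simp; ring
    have h1 : dist (x i) (z i) ≤ (R : ℝ)⁻¹ := by
      rw [Real.dist_eq, abs_le]
      constructor <;> linarith [(hx i).1, (hx i).2, (hz i).1, (hz i).2, hw]
    exact pow_le_pow_left₀ dist_nonneg h1 2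
  calc √(∑ i : Fin 3, dist (x i) (z i) ^ 2) ≤ √(∑ _i : Fin 3, ((R : ℝ)⁻¹) ^ 2) := Real.sqrt_le_sqrt (Finset.sum_le_sum fun i _ => hcoord i)
    _ = √(3 * ((R : ℝ)⁻¹) ^ 2) := by simp
    _ ≤ √((2 / R) ^ 2) := Real.sqrt_le_sqrt (by rw [div_eq_mul_inv]; nlinarith [sq_nonneg ((R : ℝ)⁻¹)])
    _ = 2 / R := Real.sqrt_sq (by positivity)

/-- Distinct lattice points give disjoint open grid cells. [folklore] -/
theorem disjoint_cell {R : ℕ} (hR : 0 < R) {y y' : Zd 3} (h : y ≠ y') :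
    Disjoint {x : EuclideanSpace ℝ (Fin 3) | ∀ i, (y i : ℝ) / R < x i ∧ x i < ((y i : ℝ) + 1) / R}
      {x : EuclideanSpace ℝ (Fin 3) | ∀ i, (y' i : ℝ) / R < x i ∧ x i < ((y' i : ℝ) + 1) / R} := by
  have hR0 : (0 : ℝ) < R := by exact_mod_cast hR
  obtain ⟨i, hi⟩ : ∃ i, y i ≠ y' i := by
    by_contra hall
    push Not at hall
    exact h (funext hall)
  rw [Set.disjoint_left]
  intro x hx hx'
  obtain ⟨h1, h2⟩ := hx i
  obtain ⟨h3, h4⟩ := hx' i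
  -- `yᵢ < R xᵢ < yᵢ + 1` and `y′ᵢ < R xᵢ < y′ᵢ + 1` force `yᵢ = y′ᵢ`
  have e1 : (y i : ℝ) < R * x i := by rwa [div_lt_iff₀ hR0, mul_comm] at h1
  have e2 : R * x i < (y i : ℝ) + 1 := by rwa [lt_div_iff₀ hR0, mul_comm] at h2
  have e3 : (y' i : ℝ) < R * x i := by rwa [div_lt_iff₀ hR0, mul_comm] at h3
  have e4 : R * x i < (y' i : ℝ) + 1 := by rwa [lt_div_iff₀ hR0, mul_comm] at h4
  have h5 : (y i : ℝ) < (y' i : ℝ) + 1 := e1.trans e4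
  have h6 : (y' i : ℝ) < (y i : ℝ) + 1 := e3.trans e2
  have h7 : y i < y' i + 1 := by exact_mod_cast h5
  have h8 : y' i < y i + 1 := by exact_mod_cast h6
  exact hi (by omega)

/-- Volume of the open sup-norm cube `{|xᵢ| < t}` of half-side `t ≥ 0`: `(2t)³` (as a real number). [folklore] -/
theorem volume_real_absCube {t : ℝ} (ht : 0 ≤ t) :
    (volume {x : EuclideanSpace ℝ (Fin 3) | ∀ i : Fin 3, |x i| < t}).toReal = 8 * t ^ 3 := by
  have h : {x : EuclideanSpace ℝ (Fin 3) | ∀ i : Fin 3, |x i| < t} =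
      (WithLp.ofLp : EuclideanSpace ℝ (Fin 3) → (Fin 3 → ℝ)) ⁻¹' (Set.pi univ fun _ => Ioo (-t) t) := by
    ext x; simp [Set.mem_pi, abs_lt]
  rw [h, (PiLp.volume_preserving_ofLp (Fin 3)).measure_preimage
    (MeasurableSet.univ_pi fun i => measurableSet_Ioo).nullMeasurableSet, Real.volume_pi_Ioo]
  simp only [Finset.prod_const, Finset.card_univ, Fintype.card_fin]
  rw [ENNReal.toReal_pow, ENNReal.toReal_ofReal (by linarith)]
  ring

/-! ## §2 A weighted square bound and the frozen-derivative mean value step -/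

/-- `(a + b)² ≤ (1 + θ)a² + (1 + θ⁻¹)b²` for `θ > 0`. [folklore] -/
theorem sq_add_le_weighted {a b θ : ℝ} (hθ : 0 < θ) : (a + b) ^ 2 ≤ (1 + θ) * a ^ 2 + (1 + θ⁻¹) * b ^ 2 := by
  have key : 2 * a * b ≤ θ * a ^ 2 + θ⁻¹ * b ^ 2 := by
    have h := sq_nonneg (θ * a - b)
    have hθ' : θ⁻¹ * (θ * a - b) ^ 2 = θ * a ^ 2 - 2 * a * b + θ⁻¹ * b ^ 2 := by
      field_simp; ring
    nlinarith [mul_nonneg (inv_nonneg.mpr hθ.le) h]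
  nlinarith [key]

/-- ★ THE FROZEN-DERIVATIVE MEAN VALUE STEP ON ONE BOND.  If `V` has derivative `D z` within the convex set `S` at every `z ∈ S`, `‖D z − D x₀‖ ≤ ω` on
`S`, and the bond endpoints `a, a + R⁻¹•e ∈ S`, then `‖V(a + R⁻¹e) − V a‖ ≤ R⁻¹(‖D x₀ e‖ + ω)` (`‖e‖ = 1`). [folklore] (Mathlib
✓`Convex.norm_image_sub_le_of_norm_hasFDerivWithin_le'`.) -/
theorem norm_sample_sub_le {F : Type*} [NormedAddCommGroup F] [NormedSpace ℝ F]
    (V : EuclideanSpace ℝ (Fin 3) → F) (D : EuclideanSpace ℝ (Fin 3) → (EuclideanSpace ℝ (Fin 3) →L[ℝ] F))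
    {S : Set (EuclideanSpace ℝ (Fin 3))} (hS : Convex ℝ S) (hD : ∀ z ∈ S, HasFDerivWithinAt V (D z) S z)
    (x₀ : EuclideanSpace ℝ (Fin 3)) {ω : ℝ} (hω : ∀ z ∈ S, ‖D z - D x₀‖ ≤ ω)
    (a : EuclideanSpace ℝ (Fin 3)) (e : EuclideanSpace ℝ (Fin 3)) (he : ‖e‖ = 1) {R : ℝ} (hR : 0 < R)
    (ha : a ∈ S) (hb : a + R⁻¹ • e ∈ S) :
    ‖V (a + R⁻¹ • e) - V a‖ ≤ R⁻¹ * (‖D x₀ e‖ + ω) := by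
  have hmv := Convex.norm_image_sub_le_of_norm_hasFDerivWithin_le' hD hω hS ha hb
  have hdiff : a + R⁻¹ • e - a = R⁻¹ • e := by abel
  rw [hdiff, map_smul, norm_smul, Real.norm_of_nonneg (inv_nonneg.mpr hR.le), he, mul_one] at hmv
  calc ‖V (a + R⁻¹ • e) - V a‖
      ≤ ‖V (a + R⁻¹ • e) - V a - R⁻¹ • D x₀ e‖ + ‖R⁻¹ • D x₀ e‖ := norm_le_norm_sub_add _ _
    _ ≤ ω * R⁻¹ + R⁻¹ * ‖D x₀ e‖ := by
        rw [norm_smul, Real.norm_of_nonneg (inv_nonneg.mpr hR.le)]; exact add_le_add hmv le_rfl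
    _ = R⁻¹ * (‖D x₀ e‖ + ω) := by ring

end Summit.QuantumFields.YangMills.Theorems.PoincareLipschitzSamplingCells

end
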